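import Summits.QuantumAdvantage.AdviceFreeQNC0.CrossFreeWindowBound
import HarnessLib

/-!
# Cell qa-qnc0 (rung F-Q1, route RingFrame, crux α `RingToElim`): the cross-free window
# theorem, polylog form, and the LOCAL-RULES THEOREM

* `ringWinU_crossFree_le` — there is `θ < 1` such that for every `C` and all large `n`: a walk
  strategy on `n` bits with selectors of degree `≤ (log₂ n)^C` admitting a window
  `[p, p+L) ++ [p+L, p+L+H) ++ [p+L+H, p+L+H+M)` with `L, M ≥ (log₂ n)^{2C+1}` such that the
  selectors at the positions strictly inside the first block do not read the third block and
  those strictly inside the third block do not read the first, wins on at most `θ·2ⁿ` inputs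
  (every charge);
* `ringWinU_localRules_le` — **THE LOCAL-RULES THEOREM**: there is `θ < 1` such that for every
  `C` and all large `n`, every walk strategy whose selectors have degree `≤ (log₂ n)^C` and RANGE
  `≤ (log₂ n)^C` (`y_g` reads only the bits `u_i` with `g − r ≤ i < g + r`, `r = (log₂ n)^C`)
  wins the ring game in walk coordinates on at most `θ·2ⁿ` inputs, every charge.  (Window at
  `p = 0` with `L = M = (log₂ n)^{2C+1}`, `H = 2(log₂ n)^C`: no selector reads across the middle
  block.)  This is the all-`n`, all-polylog-range form of the cell's kit census j255342 (dense
  local rules win at most `2/3` numerically), with an unoptimised constant.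

The cell's theorems (prover qn-prover-3, 2026-08-27); not in print.  WHAT THIS IS NOT: strategies
that read across every polylog split (general α) are untouched; no separation.

## References

* S. Srinivasan, *A robust version of Hegedűs's lemma, with applications*, TheoretiCS 2 (2023),
  Lemma 3.1 [Srinivasan2023] (through `ringWinU_crossFree_sqrt_le`).
-/

noncomputable section

namespace Summit.QuantumAdvantage.AdviceFreeQNC0

open Finset
open Literature.Computability.MetaComplexity Literature.Computability.MetaComplexity.Smolensky

variable {p L H M q : ℕ}

/-! ### Glued inputs differing in one block -/

/-- Two glued inputs differing only in the `z`-block agree off the `z`-block. -/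
theorem glue3_glue3_eq_off_z (a : Fin p → Bool) (x : Fin L → Bool) (h : Fin H → Bool)
    (z z' : Fin M → Bool) (b : Fin q → Bool) (i : Fin (p + (L + H + M) + q))
    (hi : ¬ (p + (L + H) ≤ i.val ∧ i.val < p + (L + H + M))) :
    glue3 a (glue3 x h z) b i = glue3 a (glue3 x h z') b i := by
  unfold glue3
  induction i using Fin.addCases with
  | left k =>
    simp only [Fin.append_left]
    induction k using Fin.addCases with
    | left k₀ => simp only [Fin.append_left]
    | right k₁ =>
      simp only [Fin.append_right]
      induction k₁ using Fin.addCases with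
      | left j₀ => simp only [Fin.append_left]
      | right j₁ =>
        exfalso
        have := j₁.isLt
        simp only [Fin.val_castAdd, Fin.val_natAdd] at hi
        omega
  | right k => simp only [Fin.append_right]

/-- Two glued inputs differing only in the `x`-block agree off the `x`-block. -/
theorem glue3_glue3_eq_off_x (a : Fin p → Bool) (x x' : Fin L → Bool) (h : Fin H → Bool)
    (z : Fin M → Bool) (b : Fin q → Bool) (i : Fin (p + (L + H + M) + q))
    (hi : ¬ (p ≤ i.val ∧ i.val < p + L)) :
    glue3 a (glue3 x h z) b i = glue3 a (glue3 x' h z) b i := by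
  unfold glue3
  induction i using Fin.addCases with
  | left k =>
    simp only [Fin.append_left]
    induction k using Fin.addCases with
    | left k₀ => simp only [Fin.append_left]
    | right k₁ =>
      simp only [Fin.append_right]
      induction k₁ using Fin.addCases with
      | left j₀ =>
        induction j₀ using Fin.addCases with
        | left l₀ =>
          exfalso
          have := l₀.isLt
          simp only [Fin.val_castAdd, Fin.val_natAdd] at hi
          omega
        | right l₁ => simp only [Fin.append_left, Fin.append_right]
      | right j₁ => simp only [Fin.append_right]
  | right k => simp only [Fin.append_right]

/-- Degree bookkeeping: `k^C ≤ c₁·√L` once `c₁·√k ≥ 1` and `L ≥ k^{2C+1}`. -/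
private theorem pow_le_mul_sqrt' {c₁ : ℝ} (hc₁ : 0 < c₁) {k C L : ℕ} (hck : 1 ≤ c₁ * Real.sqrt k)
    (hL : k ^ (2 * C + 1) ≤ L) : ((k ^ C : ℕ) : ℝ) ≤ c₁ * Real.sqrt L := by
  have hsqrt : (k : ℝ) ^ C * Real.sqrt k ≤ Real.sqrt L := by
    have h2 : ((k ^ (2 * C + 1) : ℕ) : ℝ) ≤ L := by exact_mod_cast hL
    have h1 : ((k : ℝ) ^ C) ^ 2 * k ≤ L := by
      calc ((k : ℝ) ^ C) ^ 2 * k = (k : ℝ) ^ (2 * C + 1) := by ring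
        _ ≤ L := by push_cast at h2; exact h2
    calc (k : ℝ) ^ C * Real.sqrt k = Real.sqrt (((k : ℝ) ^ C) ^ 2 * k) := by
          rw [Real.sqrt_mul (by positivity), Real.sqrt_sq (by positivity)]
      _ ≤ Real.sqrt L := Real.sqrt_le_sqrt h1
  push_cast
  calc (k : ℝ) ^ C = (k : ℝ) ^ C * 1 := (mul_one _).symm
    _ ≤ (k : ℝ) ^ C * (c₁ * Real.sqrt k) := mul_le_mul_of_nonneg_left hck (by positivity)
    _ = c₁ * ((k : ℝ) ^ C * Real.sqrt k) := by ring
    _ ≤ c₁ * Real.sqrt L := mul_le_mul_of_nonneg_left hsqrt hc₁.le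

/-- `c₁ √k ≥ 1` once `k ≥ ⌈1/c₁²⌉ + 1`. -/
private theorem one_le_mul_sqrt {c₁ : ℝ} (hc₁ : 0 < c₁) {k : ℕ} (hk : ⌈1 / c₁ ^ 2⌉₊ + 1 ≤ k) :
    1 ≤ c₁ * Real.sqrt k := by
  have h2 : ((⌈1 / c₁ ^ 2⌉₊ : ℕ) : ℝ) + 1 ≤ k := by exact_mod_cast hk
  have h3 : (1 / c₁ ^ 2 : ℝ) ≤ ((⌈1 / c₁ ^ 2⌉₊ : ℕ) : ℝ) := Nat.le_ceil _
  have h1 : (1 / c₁ ^ 2 : ℝ) ≤ k := by linarith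
  rw [div_le_iff₀ (by positivity)] at h1
  calc (1 : ℝ) = Real.sqrt 1 := Real.sqrt_one.symm
    _ ≤ Real.sqrt (c₁ ^ 2 * k) := Real.sqrt_le_sqrt (by linarith)
    _ = c₁ * Real.sqrt k := by rw [Real.sqrt_mul (by positivity), Real.sqrt_sq hc₁.le]

/-! ### The polylog form -/

/-- **THE CROSS-FREE WINDOW THEOREM (polylog form).**  There is `θ < 1` such that for every `C`
and all large `n`: every walk strategy on `n` bits with selectors of degree `≤ (log₂ n)^C` for
which some window `[p, p+L) ++ [p+L, p+L+H) ++ [p+L+H, p+L+H+M)` (`L, M ≥ (log₂ n)^{2C+1}`,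
`p + L + H + M ≤ n`) is CROSS-FREE — a selector at a position strictly inside the first block
takes equal values on inputs that agree off the third block, and symmetrically — wins the ring
game in walk coordinates, for every charge, on at most `θ·2ⁿ` inputs.
[cite: Srinivasan2023, Lemma 3.1] -/
theorem ringWinU_crossFree_le :
    ∃ θ : ℝ, θ < 1 ∧ ∀ C : ℕ, ∃ n₀ : ℕ, ∀ n ≥ n₀, ∀ p L H M : ℕ, p + (L + H + M) ≤ n →
      (Nat.log 2 n) ^ (2 * C + 1) ≤ L → (Nat.log 2 n) ^ (2 * C + 1) ≤ M →
      ∀ c : ℕ, ∀ y : Fin (n + 1) → (Fin n → Bool) → Bool,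
        (∀ g, HasDeg (y g) ((Nat.log 2 n) ^ C)) →
        (∀ g : Fin (n + 1), p < g.val → g.val < p + L → ∀ u u' : Fin n → Bool,
          (∀ i : Fin n, ¬ (p + (L + H) ≤ i.val ∧ i.val < p + (L + H + M)) → u i = u' i) →
          y g u = y g u') →
        (∀ g : Fin (n + 1), p + (L + H) < g.val → g.val < p + (L + H + M) → ∀ u u' : Fin n → Bool,
          (∀ i : Fin n, ¬ (p ≤ i.val ∧ i.val < p + L) → u i = u' i) → y g u = y g u') →
          ((univ.filter fun u : Fin n → Bool => ringWinU c y u = true).card : ℝ) ≤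
            θ * (2 : ℝ) ^ n := by
  obtain ⟨θ, hθ, c₁, hc₁, ℓ₀, Hsq⟩ := ringWinU_crossFree_sqrt_le
  refine ⟨θ, hθ, fun C => ⟨2 ^ (max (ℓ₀ + 1) (⌈1 / c₁ ^ 2⌉₊ + 1)), ?_⟩⟩
  intro n hn p L H M hpn hL hM c y hdeg hX hZ
  obtain ⟨q, rfl⟩ : ∃ q, n = p + (L + H + M) + q := ⟨n - (p + (L + H + M)), by omega⟩
  set k := Nat.log 2 (p + (L + H + M) + q) with hk
  have hm : max (ℓ₀ + 1) (⌈1 / c₁ ^ 2⌉₊ + 1) ≤ k := Nat.le_log_of_pow_le one_lt_two hn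
  have hkℓ : ℓ₀ + 1 ≤ k := le_trans (le_max_left _ _) hm
  have hk1 : ⌈1 / c₁ ^ 2⌉₊ + 1 ≤ k := le_trans (le_max_right _ _) hm
  have hkk : k ≤ k ^ (2 * C + 1) := Nat.le_self_pow (by omega) k
  have hℓ₀L : ℓ₀ ≤ L := by omega
  have hℓ₀M : ℓ₀ ≤ M := by omega
  have hck := one_le_mul_sqrt hc₁ hk1
  have hDL := pow_le_mul_sqrt' (C := C) hc₁ hck hL
  have hDM := pow_le_mul_sqrt' (C := C) hc₁ hck hM
  refine Hsq p L H M q hℓ₀L hℓ₀M _ hDL hDM c y hdeg ?_ ?_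
  · intro g h1 h2 a x h z z' b
    exact hX g h1 h2 _ _ fun i hi => glue3_glue3_eq_off_z a x h z z' b i hi
  · intro g h1 h2 a x x' h z b
    exact hZ g h1 h2 _ _ fun i hi => glue3_glue3_eq_off_x a x x' h z b i hi

/-! ### Local rules -/

/-- **THE LOCAL-RULES THEOREM.**  There is `θ < 1` such that for every `C` and all large `n`:
every walk strategy on `n` bits whose selectors have degree `≤ (log₂ n)^C` and RANGE
`≤ (log₂ n)^C` — `y_g(u)` depends only on the bits `u_i` with `g ≤ i + (log₂ n)^C` and
`i < g + (log₂ n)^C` — wins the ring game in walk coordinates, for every charge, on at most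
`θ·2ⁿ` inputs.  (The window `[0, L) ++ [L, L + 2r) ++ [L + 2r, 2L + 2r)`, `L = (log₂ n)^{2C+1}`,
`r = (log₂ n)^C`, is cross-free for a range-`r` strategy.)  All dense LOCAL strategies of the
cell's census (kit j255342: numerically at most `2/3`) are covered for all `n`, all polylog
ranges, with an unoptimised constant. [cite: Srinivasan2023, Lemma 3.1] -/
theorem ringWinU_localRules_le :
    ∃ θ : ℝ, θ < 1 ∧ ∀ C : ℕ, ∃ n₀ : ℕ, ∀ n ≥ n₀, ∀ c : ℕ,
      ∀ y : Fin (n + 1) → (Fin n → Bool) → Bool,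
        (∀ g, HasDeg (y g) ((Nat.log 2 n) ^ C)) →
        (∀ g : Fin (n + 1), ∀ u u' : Fin n → Bool,
          (∀ i : Fin n, g.val ≤ i.val + (Nat.log 2 n) ^ C → i.val < g.val + (Nat.log 2 n) ^ C →
            u i = u' i) → y g u = y g u') →
          ((univ.filter fun u : Fin n → Bool => ringWinU c y u = true).card : ℝ) ≤
            θ * (2 : ℝ) ^ n := by
  obtain ⟨θ, hθ, Hpoly⟩ := ringWinU_crossFree_le
  refine ⟨θ, hθ, fun C => ?_⟩
  obtain ⟨n₁, hn₁⟩ := Hpoly C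
  -- room: `4 (log₂ n)^{2C+1} ≤ n` for large `n`
  obtain ⟨n₂, hn₂⟩ := logPow_le_sqrt' (2 * C + 1) (c₀ := 1 / 4) (by norm_num)
  refine ⟨max n₁ (max n₂ 2), fun n hn c y hdeg hloc => ?_⟩
  have hn₁n : n₁ ≤ n := le_trans (le_max_left _ _) hn
  have hn₂n : n₂ ≤ n := le_trans (le_trans (le_max_left _ _) (le_max_right _ _)) hn
  have hn2 : 2 ≤ n := le_trans (le_trans (le_max_right _ _) (le_max_right _ _)) hn
  set k := Nat.log 2 n with hk
  have hk1 : 1 ≤ k := Nat.le_log_of_pow_le one_lt_two (by simpa using hn2)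
  -- `4 k^{2C+1} ≤ n`
  have hroom : 4 * k ^ (2 * C + 1) ≤ n := by
    have h1 : ((k ^ (2 * C + 1) : ℕ) : ℝ) ≤ 1 / 4 * Real.sqrt n := hn₂ n hn₂n
    have h2 : Real.sqrt n ≤ n := by
      have hn1 : (1 : ℝ) ≤ n := by exact_mod_cast (le_trans (by norm_num) hn2)
      calc Real.sqrt n ≤ Real.sqrt n * Real.sqrt n :=
            le_mul_of_one_le_right (Real.sqrt_nonneg _) (by rw [← Real.sqrt_one]; exact Real.sqrt_le_sqrt hn1)
        _ = n := Real.mul_self_sqrt (by positivity)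
    have h3 : ((4 * k ^ (2 * C + 1) : ℕ) : ℝ) ≤ n := by push_cast at h1 ⊢; linarith
    exact_mod_cast h3
  have hkC : k ^ C ≤ k ^ (2 * C + 1) := Nat.pow_le_pow_right hk1 (by omega)
  -- the window at `p = 0`: `L = M = k^{2C+1}`, `H = 2 k^C`
  refine hn₁ n hn₁n 0 (k ^ (2 * C + 1)) (2 * k ^ C) (k ^ (2 * C + 1)) (by omega) le_rfl le_rfl
    c y hdeg ?_ ?_
  · intro g h1 h2 u u' huu'
    refine hloc g u u' fun i hi1 hi2 => huu' i ?_
    omega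
  · intro g h1 h2 u u' huu'
    refine hloc g u u' fun i hi1 hi2 => huu' i ?_
    omega

end Summit.QuantumAdvantage.AdviceFreeQNC0
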